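import Literature.Analysis.FluidPDE.NSBoundedMildOseenIntegral
import HarnessLib

/-!
# The Oseen representation `u(t) = e^{νtΔ}u(0) - B^ν_0(u,u)(t)` of bounded finite-energy
# duality-form mild solutions, and the weighted sup-norm bound for the Duhamel term

Analysis/FluidPDE support file for the discharge of the named fact
`Literature.Analysis.FluidPDE.leray_supnorm_le_of_Lp` (`NSLerayBlowupRateLp.lean`; Leray 1934,
§21; Ożański–Pooley 2018, Lemma 6.23 (iii)), whose printed proof rests on the representation
formula (Ożański–Pooley 2018, (6.55); Leray 1934, (3.2))
`u(t) = Φ(νt) ∗ u(0) + ∫₀ᵗ ∇𝒯(ν(t-s)) ∗ [u(s)u(s)] ds` of a strong solution and on the kernel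
bound behind (6.65), `‖∇𝒯(ν(t-s)) ∗ [u u](s)‖_∞ ≤ C' ‖u(s)‖²_∞ (ν(t-s))^{-1/2}`
(Ożański–Pooley 2018, Lemma 6.9 (i); Leray 1934, (2.13)). In the tree's vocabulary the
right-hand side is `heatExtension (u 0) (νt) - oseenDuhamel ν 0 u u t`
(`NSBoundedMildOseen.lean`, Koch–Nadirashvili–Seregin–Šverák 2009, §§3–4), and this file proves:

* `exists_lintegral_enorm_oseenKernel_weighted_le`, `exists_enorm_oseenDuhamel_weighted_le` —
  **the weighted `L^∞` majorant of the Duhamel term**: if `‖u(τ, ·)‖, ‖v(τ, ·)‖ ≤ V(τ)` on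
  `(s, t)` then `‖B^ν_s(u,v)(t)(x)‖ ≤ ∫_{(s,t)} C V(τ)² (ν(t-τ))^{-1/2} dτ` (as a `∫⁻`), the
  time-dependent twin of `exists_lintegral_enorm_oseenKernel_bounded_le` /
  `exists_norm_oseenDuhamel_bounded_le` (KNSS 2009, §4 p. 8: the bound for `B`), from the same
  kernel bound `‖K(σ,z)[a,b]‖ ≤ C₀ (σ + ‖z‖²)^{-(d+1)/2} ‖a‖ ‖b‖` (`exists_norm_oseenKernel_le`);
* `ae_eq_heatExtension_sub_oseenDuhamel_of_isMildNSSolutionOn` — **duality form ⇒ Oseen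
  integral form for bounded finite-energy fields**: let `ν > 0` and let `u` be jointly measurable
  on `(0, T) × E`, with measurable slices bounded by `M` on `[0, T] × E` and square integrable, a
  weakly divergence-free datum `u 0`, and a mild solution on `(0, T]` in the duality form from
  `u 0` (`IsMildNSSolutionOn (Ioc 0 T) ν 0 (u 0) u`). Then for every `t ∈ (0, T]`,
  `u(t) = e^{νtΔ}u(0) - B^ν_0(u,u)(t)` a.e. (Lemarié-Rieusset 2016, Thm. 6.1 with Prop. 6.5:
  very weak solutions in `L^∞_t L²_x` are Oseen solutions; Fabes–Jones–Rivière 1972, Thm. 2.1).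
  Proof: exactly as in the tree's (A1) `exists_const_oseenMild_of_bounded_isBesovMildSolutionOn`
  (`NSBoundedMildOseenDuhamel.lean`), the bounded field `z = e^{νtΔ}u(0) - B^ν_0(u,u)(t) - u(t)`
  annihilates solenoidal tests (the duality identity at `t`, the symmetry of the caloric pairing,
  `integral_inner_oseenDuhamel_eq_neg_intervalIntegral`) and is weakly divergence free, hence is
  a.e. a constant `c` (annihilator lemma in `L^∞`, `BoundedAnnihilator.lean`; KNSS 2009,
  Lemma 3.1: the drift); and here `c = 0` because all three pieces vanish at infinity under the
  heat flow: `e^{τΔ}z = c` for every `τ > 0`, while `e^{τΔ}e^{νtΔ}u(0)`, `e^{τΔ}u(t) → 0`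
  pointwise (`L²` data, `tendsto_enorm_heatExtension_atTop`) and `e^{τΔ}B^ν_0(u,u)(t) = O(τ^{-1/2})`
  (`exists_norm_heatExtension_oseenDuhamel_le`) — finite energy replaces the Besov realisation
  clause used in the tree's (A).

In the application (`NSLerayBlowupRateLpProofs.lean`) `u` is a classical solution on `[0, T)`
which is Leray–Hopf from `u(0)` and bounded on closed sub-strips; it is duality-form mild by the
tree's `isMildNSSolutionOn_of_isLerayHopfOn_holds`.

## References

* W. S. Ożański, B. C. Pooley, in: Partial Differential Equations in Fluid Mechanics, LMS Lecture
  Note Ser. 452, CUP 2018, Lemma 6.9 (i), (6.47), (6.55), (6.65). [OzanskiPooley2018]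
* J. Leray, Acta Math. 63 (1934), §§11–12 (2.13), §15 (3.2), §21 (3.5). [Leray1934]
* G. Koch, N. Nadirashvili, G. Seregin, V. Šverák, Acta Math. 203 (2009) = arXiv:0709.3599,
  §3 p. 7 (Lemma 3.1), §4 p. 8 (the bilinear form `B` and its bound). [KochNadirashviliSereginSverak2009]
* P. G. Lemarié-Rieusset, *The Navier–Stokes problem in the 21st century*, CRC Press 2016,
  Thm. 6.1 with Prop. 6.5 (pp. 133–136). [LemarieRieusset2016]
* E. B. Fabes, B. F. Jones, N. M. Rivière, ARMA 45 (1972), Thm. 2.1. [FabesJonesRiviere1972]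
-/

noncomputable section

open MeasureTheory Set Function Filter TopologicalSpace InnerProductSpace Metric
open _root_.Topology
open scoped RealInnerProductSpace NNReal ENNReal

namespace Literature.Analysis.FluidPDE

variable {E : Type*} [NormedAddCommGroup E] [InnerProductSpace ℝ E] [FiniteDimensional ℝ E]
  [MeasurableSpace E] [BorelSpace E]

/-! ### The weighted majorant of the Duhamel term -/

section Weighted

/-- **Weighted majorant of the Oseen Duhamel integrand** (time-dependent twin of
`exists_lintegral_enorm_oseenKernel_bounded_le`; Ożański–Pooley 2018, Lemma 6.9 (i):
`‖∇𝒯(t-s) ∗ [Y Y](s)‖_∞ ≤ C ‖Y(s)‖²_∞ (t-s)^{-1/2}`; KNSS 2009, §4 p. 8): there is `C = C(E) > 0`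
such that for fields `u`, `v` with `‖u(τ, ·)‖, ‖v(τ, ·)‖ ≤ V(τ)` (`V ≥ 0`) on `(s, t)`, `ν > 0` and
every `x`,
`∫_{(s,t)} ∫ ‖K(ν(t-τ), x-y)[u(τ,y), v(τ,y)]‖ dy dτ ≤ ∫_{(s,t)} C V(τ)² (ν(t-τ))^{-1/2} dτ`
(iterated `∫⁻`; no measurability is needed). [cite: OzanskiPooley2018, Lemma 6.9 (i)] -/
theorem exists_lintegral_enorm_oseenKernel_weighted_le :
    ∃ C : ℝ, 0 < C ∧ ∀ {ν : ℝ}, 0 < ν → ∀ {u v : ℝ → E → E} {s t : ℝ} {V : ℝ → ℝ},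
      (∀ τ ∈ Ioo s t, 0 ≤ V τ) →
      (∀ τ ∈ Ioo s t, ∀ y, ‖u τ y‖ ≤ V τ) → (∀ τ ∈ Ioo s t, ∀ y, ‖v τ y‖ ≤ V τ) → ∀ x : E,
        ∫⁻ τ in Ioo s t, ∫⁻ y, ‖oseenKernel (ν * (t - τ)) (x - y) (u τ y) (v τ y)‖ₑ ≤
          ∫⁻ τ in Ioo s t, ENNReal.ofReal (C * V τ ^ 2 * (ν * (t - τ)) ^ (-(1 / 2 : ℝ))) := by
  set d : ℝ := (Module.finrank ℝ E : ℝ) with hd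
  obtain ⟨C₀, hC₀, hK⟩ := exists_norm_oseenKernel_le (E := E)
  set I : ℝ := ∫ w : E, (1 + ‖w‖ ^ 2) ^ (-((d + 1) / 2)) with hI
  have he : d < 2 * ((d + 1) / 2) := by linarith
  have hI0 : 0 < I := integral_one_add_norm_sq_rpow_neg_pos he
  refine ⟨C₀ * I, by positivity, fun {ν} hν {u v s t V} hV0 hu hv x => ?_⟩
  have hscal : d / 2 - (d + 1) / 2 = -(1 / 2 : ℝ) := by ring
  refine setLIntegral_mono' measurableSet_Ioo fun τ hτ => ?_
  have hσ : 0 < ν * (t - τ) := mul_pos hν (sub_pos.2 hτ.2)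
  have hVτ : 0 ≤ V τ := hV0 τ hτ
  calc ∫⁻ y, ‖oseenKernel (ν * (t - τ)) (x - y) (u τ y) (v τ y)‖ₑ
      ≤ ∫⁻ y, ENNReal.ofReal (C₀ * V τ ^ 2) *
          ENNReal.ofReal ((ν * (t - τ) + ‖x - y‖ ^ 2) ^ (-((d + 1) / 2))) := by
        refine lintegral_mono fun y => ?_
        rw [← ofReal_norm, ← ENNReal.ofReal_mul (by positivity)]
        refine ENNReal.ofReal_le_ofReal ?_
        calc ‖oseenKernel (ν * (t - τ)) (x - y) (u τ y) (v τ y)‖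
            ≤ C₀ * (ν * (t - τ) + ‖x - y‖ ^ 2) ^ (-((d + 1) / 2)) * ‖u τ y‖ * ‖v τ y‖ :=
              hK hσ (x - y) _ _
          _ ≤ C₀ * (ν * (t - τ) + ‖x - y‖ ^ 2) ^ (-((d + 1) / 2)) * V τ * V τ := by
              gcongr
              · exact hu τ hτ y
              · exact hv τ hτ y
          _ = C₀ * V τ ^ 2 * (ν * (t - τ) + ‖x - y‖ ^ 2) ^ (-((d + 1) / 2)) := by ring
    _ = ENNReal.ofReal (C₀ * V τ ^ 2) *
          ∫⁻ y, ENNReal.ofReal ((ν * (t - τ) + ‖x - y‖ ^ 2) ^ (-((d + 1) / 2))) :=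
        lintegral_const_mul' _ _ ENNReal.ofReal_ne_top
    _ = ENNReal.ofReal (C₀ * V τ ^ 2) *
          ENNReal.ofReal ((ν * (t - τ)) ^ (d / 2 - (d + 1) / 2) * I) := by
        rw [lintegral_weight_sub_left, lintegral_add_norm_sq_rpow_neg he hσ]
    _ = ENNReal.ofReal (C₀ * I * V τ ^ 2 * (ν * (t - τ)) ^ (-(1 / 2 : ℝ))) := by
        rw [← ENNReal.ofReal_mul (by positivity), hscal]
        ring_nf

/-- **The weighted `L^∞` bound for the Duhamel term** (Ożański–Pooley 2018, Lemma 6.9 (i), the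
first inequality of (6.58) and of (6.65): `‖∫₀ᵗ ∇𝒯(t-s) ∗ [Y Y](s) ds‖_∞ ≤ C' ∫₀ᵗ
‖Y(s)‖²_∞ (t-s)^{-1/2} ds`; Leray 1934, (2.13)): with the constant of
`exists_lintegral_enorm_oseenKernel_weighted_le`,
`‖B^ν_s(u,v)(t)(x)‖ ≤ ∫_{(s,t)} C V(τ)² (ν(t-τ))^{-1/2} dτ` whenever `‖u(τ,·)‖, ‖v(τ,·)‖ ≤ V(τ)` on
`(s, t)`. [cite: OzanskiPooley2018, Lemma 6.9 (i), (6.65)] -/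
theorem exists_enorm_oseenDuhamel_weighted_le :
    ∃ C : ℝ, 0 < C ∧ ∀ {ν : ℝ}, 0 < ν → ∀ {u v : ℝ → E → E} {s t : ℝ} {V : ℝ → ℝ},
      (∀ τ ∈ Ioo s t, 0 ≤ V τ) →
      (∀ τ ∈ Ioo s t, ∀ y, ‖u τ y‖ ≤ V τ) → (∀ τ ∈ Ioo s t, ∀ y, ‖v τ y‖ ≤ V τ) → ∀ x : E,
        ‖oseenDuhamel ν s u v t x‖ₑ ≤
          ∫⁻ τ in Ioo s t, ENNReal.ofReal (C * V τ ^ 2 * (ν * (t - τ)) ^ (-(1 / 2 : ℝ))) := by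
  obtain ⟨C, hC, h⟩ := exists_lintegral_enorm_oseenKernel_weighted_le (E := E)
  refine ⟨C, hC, fun {ν} hν {u v s t V} hV0 hu hv x => ?_⟩
  set F : ℝ × E → E := fun p => oseenKernel (ν * (t - p.1)) (x - p.2) (u p.1 p.2) (v p.1 p.2) with hF
  calc ‖oseenDuhamel ν s u v t x‖ₑ
      ≤ ∫⁻ τ in Ioo s t, ‖∫ y, F (τ, y)‖ₑ := enorm_integral_le_lintegral_enorm _
    _ ≤ ∫⁻ τ in Ioo s t, ∫⁻ y, ‖F (τ, y)‖ₑ :=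
        lintegral_mono fun τ => enorm_integral_le_lintegral_enorm _
    _ ≤ _ := h hν hV0 hu hv x

end Weighted

/-! ### The representation formula for bounded finite-energy duality-form mild solutions -/

section Representation

variable {ν T M : ℝ} {u : ℝ → E → E}

/-- **Bounded duality-form mild solutions solve the Oseen integral equation up to a constant**
(the tree's (A1) argument, `exists_const_oseenMild_of_bounded_isBesovMildSolutionOn`, run for an
everywhere-bounded field: KNSS 2009, Lemma 3.1 / Rem. 3.1, the drift `b(t)`). Let `ν > 0`, let `u`
be jointly measurable on `(0, T) × E` with measurable slices bounded by `M` on `[0, T]`, a weakly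
divergence-free datum `u 0`, and the duality identities from `u 0` on `(0, T]`. Then for every
`t ∈ (0, T]` there is `c` with `u(t) = e^{νtΔ}u(0) - B^ν_0(u,u)(t) - c` a.e. [cite: KochNadirashviliSereginSverak2009, Lemma 3.1 and Rem. 3.1 (arXiv:0709.3599 p. 7)] -/
theorem exists_const_oseenMild_of_bounded_isMildNSSolutionOn (hν : 0 < ν) (hT : 0 < T)
    (hmild : IsMildNSSolutionOn (Ioc 0 T) ν 0 (u 0) u)
    (hmeas : AEStronglyMeasurable (uncurry u) ((volume : Measure (ℝ × E)).restrict (Ioo 0 T ×ˢ univ)))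
    (hsl : ∀ t ∈ Icc 0 T, AEStronglyMeasurable (u t) volume) (hM : 0 < M)
    (hbd : ∀ t ∈ Icc 0 T, ∀ y, ‖u t y‖ ≤ M) (hdiv0 : IsWeaklyDivFree (u 0))
    {t : ℝ} (ht : t ∈ Ioc 0 T) :
    ∃ c : E, u t =ᵐ[volume] fun x =>
      UnboundedOperators.heatExtension (u 0) (ν * t) x - oseenDuhamel ν 0 u u t x - c := by
  haveI : CompleteSpace E := FiniteDimensional.complete ℝ E
  have h0I : (0 : ℝ) ∈ Icc 0 T := ⟨le_rfl, hT.le⟩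
  have htI : t ∈ Icc 0 T := ⟨ht.1.le, ht.2⟩
  have hbd' : ∀ τ ∈ Ioo 0 T, ∀ y, ‖u τ y‖ ≤ M := fun τ hτ y => hbd τ ⟨hτ.1.le, hτ.2.le⟩ y
  have hνt : 0 < ν * t := mul_pos hν ht.1
  -- the three bounded pieces
  set h : E → E := UnboundedOperators.heatExtension (u 0) (ν * t) with hh
  set Bt : E → E := oseenDuhamel ν 0 u u t with hBt
  have hu0m : MemLp (u 0) ∞ (volume : Measure E) :=
    memLp_top_of_bound (hsl 0 h0I) M (Eventually.of_forall (hbd 0 h0I))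
  have hh_cont : Continuous h :=
    (UnboundedOperators.contDiff_heatExtension_holds hu0m le_top hνt).continuous
  have hh_bd : ∀ x, ‖h x‖ ≤ M := fun x => UnboundedOperators.norm_heatExtension_le (hbd 0 h0I) hνt x
  have hh_m : MemLp h ∞ (volume : Measure E) :=
    memLp_top_of_bound hh_cont.aestronglyMeasurable M (Eventually.of_forall hh_bd)
  obtain ⟨CB, hCB, hCBle⟩ := exists_norm_oseenDuhamel_bounded_le (E := E)
  have hBt_bd : ∀ x, ‖Bt x‖ ≤ CB * M ^ 2 * ν ^ (-(1 / 2 : ℝ)) * (2 * Real.sqrt (t - 0)) := fun x =>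
    hCBle hν ht.1 hM.le (fun τ hτ y => hbd' τ ⟨hτ.1, hτ.2.trans_le ht.2⟩ y)
      (fun τ hτ y => hbd' τ ⟨hτ.1, hτ.2.trans_le ht.2⟩ y) x
  have hBt_meas : AEStronglyMeasurable Bt (volume : Measure E) :=
    aestronglyMeasurable_oseenDuhamel hν hmeas hmeas hM.le hbd' hbd' ht.1 ht.2
  have hBt_m : MemLp Bt ∞ (volume : Measure E) :=
    memLp_top_of_bound hBt_meas _ (Eventually.of_forall hBt_bd)
  have hut_m : MemLp (u t) ∞ (volume : Measure E) :=
    memLp_top_of_bound (hsl t htI) M (Eventually.of_forall (hbd t htI))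
  -- the field `z = h - Bt - u t`
  set z : E → E := fun x => h x - Bt x - u t x with hz
  have hz_meas : AEStronglyMeasurable z volume :=
    (hh_cont.aestronglyMeasurable.sub hBt_meas).sub (hsl t htI)
  have hz_bd : ∀ x, ‖z x‖ ≤ M + CB * M ^ 2 * ν ^ (-(1 / 2 : ℝ)) * (2 * Real.sqrt (t - 0)) + M := by
    intro x
    calc ‖z x‖ ≤ ‖h x - Bt x‖ + ‖u t x‖ := norm_sub_le _ _
      _ ≤ (‖h x‖ + ‖Bt x‖) + ‖u t x‖ := by gcongr; exact norm_sub_le _ _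
      _ ≤ (M + CB * M ^ 2 * ν ^ (-(1 / 2 : ℝ)) * (2 * Real.sqrt (t - 0))) + M := by
          gcongr
          · exact hh_bd x
          · exact hBt_bd x
          · exact hbd t htI x
  -- weak divergence freeness of `z`
  have hdivh : IsWeaklyDivFree h := hdiv0.heatExtension_of_bound (hsl 0 h0I) (hbd 0 h0I) hνt
  have hdivB : IsWeaklyDivFree Bt :=
    isWeaklyDivFree_oseenDuhamel hν hmeas hmeas hM.le hbd' hbd' ht.1 ht.2
  have hdivut : IsWeaklyDivFree (u t) := hmild.1 t ht
  have hz_div : IsWeaklyDivFree z := by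
    have h1 : IsWeaklyDivFree (h - Bt) := IsWeaklyDivFree.sub le_top hdivh hdivB hh_m hBt_m
    have h2 : IsWeaklyDivFree (h - Bt - u t) :=
      IsWeaklyDivFree.sub le_top h1 hdivut (hh_m.sub hBt_m) hut_m
    exact h2
  -- `z` annihilates divergence-free test fields: the duality identity at `t`
  have hz_orth : ∀ φ : E → E, FunctionSpaces.IsTestFunctionOn (⊤ : Opens E) φ →
      VectorCalculus.IsDivFree φ → ∫ x, ⟪z x, φ x⟫ = 0 := by
    intro φ hφ hφd
    have hφc := hφ.hasCompactSupport
    have hφcont := hφ.contDiff.continuous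
    have key := hmild.2 t ht φ hφ hφd
    have hzero : (∫ τ in (0 : ℝ)..t, ∫ x, ⟪(0 : ℝ → E → E) τ x, heatTest ν φ (t - τ) x⟫) = 0 := by
      simp
    rw [hzero, add_zero] at key
    -- the three pairings
    have e1 : ∫ x, ⟪h x, φ x⟫ = ∫ x, ⟪u 0 x, heatTest ν φ t x⟫ := by
      rw [hh, integral_inner_heatExtension_comm_of_bound (hsl 0 h0I) (hbd 0 h0I) hφcont hφc hνt,
        heatTest_of_pos hν ht.1]
    have e2 : ∫ x, ⟪Bt x, φ x⟫ =
        -∫ τ in (0 : ℝ)..t, ∫ y, ⟪u τ y, convect (u τ) (heatTest ν φ (t - τ)) y⟫ :=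
      integral_inner_oseenDuhamel_eq_neg_intervalIntegral hν hmeas hM.le hbd' ht.1 ht.2 hφ hφd
    -- integrability of the pairings
    have i1 : Integrable (fun x => ⟪h x, φ x⟫) (volume : Measure E) :=
      integrable_inner_of_hasCompactSupport_right hh_cont hφcont hφc
    have i2 : Integrable (fun x => ⟪Bt x, φ x⟫) (volume : Measure E) :=
      integrable_inner_of_aestronglyMeasurable_of_norm_le hBt_meas hBt_bd
        (hφcont.integrable_of_hasCompactSupport hφc)
    have i3 : Integrable (fun x => ⟪u t x, φ x⟫) (volume : Measure E) :=
      integrable_inner_of_aestronglyMeasurable_of_norm_le (hsl t htI) (hbd t htI)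
        (hφcont.integrable_of_hasCompactSupport hφc)
    have i12 : Integrable (fun x => ⟪h x, φ x⟫ - ⟪Bt x, φ x⟫) (volume : Measure E) := i1.sub i2
    have esplit : ∫ x, ⟪z x, φ x⟫ =
        (∫ x, ⟪h x, φ x⟫) - (∫ x, ⟪Bt x, φ x⟫) - ∫ x, ⟪u t x, φ x⟫ := by
      simp only [hz, inner_sub_left]
      rw [integral_sub i12 i3, integral_sub i1 i2]
    rw [esplit, e1, e2, key]
    ring
  -- the annihilator lemma
  obtain ⟨c, hc⟩ := hz_div.exists_ae_eq_const_of_norm_le_of_forall_integral_inner_eq_zero hz_meas hz_bd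
    hz_orth
  refine ⟨c, ?_⟩
  filter_upwards [hc] with x hx
  simp only [hz] at hx
  rw [← hx]
  abel

/-- **Bounded finite-energy duality-form mild solutions solve the Oseen integral equation**
(Ożański–Pooley 2018, (6.55): the representation formula of strong solutions on `[0, T)`;
Leray 1934, (3.2); Lemarié-Rieusset 2016, Thm. 6.1 with Prop. 6.5: very weak solutions in
`L^∞((0,T), L²)` are Oseen solutions, i.e. satisfy (6.12)
`u = W_{νt} ∗ u₀ - ∫₀ᵗ Σⱼ ∂ⱼ𝒪(ν(t-s)) :: (uⱼ u) ds`; Fabes–Jones–Rivière 1972, Thm. 2.1). Let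
`ν > 0` and let `u` be jointly measurable on `(0, T) × E`, with measurable square-integrable slices
bounded by `M` on `[0, T] × E`, a weakly divergence-free datum `u 0`, and the duality identities
from `u 0` on `(0, T]` (`IsMildNSSolutionOn (Ioc 0 T) ν 0 (u 0) u`). Then for every `t ∈ (0, T]`,
`u(t) = e^{νtΔ}u(0) - B^ν_0(u,u)(t)` a.e. Proof: by
`exists_const_oseenMild_of_bounded_isMildNSSolutionOn` the identity holds up to a constant `c`,
and `c = e^{τΔ}(e^{νtΔ}u(0) - B^ν_0(u,u)(t) - u(t))(0) → 0` as `τ → ∞` (`L²` slices: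
`tendsto_enorm_heatExtension_atTop`; Duhamel term: `exists_norm_heatExtension_oseenDuhamel_le`).
[cite: OzanskiPooley2018, (6.55)] [cite: LemarieRieusset2016, Thm. 6.1 with Prop. 6.5 (pp. 133–136)] [cite: FabesJonesRiviere1972, Thm. 2.1] -/
theorem ae_eq_heatExtension_sub_oseenDuhamel_of_isMildNSSolutionOn [Nontrivial E] (hν : 0 < ν)
    (hT : 0 < T) (hmild : IsMildNSSolutionOn (Ioc 0 T) ν 0 (u 0) u)
    (hmeas : AEStronglyMeasurable (uncurry u) ((volume : Measure (ℝ × E)).restrict (Ioo 0 T ×ˢ univ)))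
    (hsl : ∀ t ∈ Icc 0 T, AEStronglyMeasurable (u t) volume) (hM : 0 < M)
    (hbd : ∀ t ∈ Icc 0 T, ∀ y, ‖u t y‖ ≤ M) (hdiv0 : IsWeaklyDivFree (u 0))
    (h2 : ∀ t ∈ Icc 0 T, MemLp (u t) 2 volume) {t : ℝ} (ht : t ∈ Ioc 0 T) :
    u t =ᵐ[volume] fun x =>
      UnboundedOperators.heatExtension (u 0) (ν * t) x - oseenDuhamel ν 0 u u t x := by
  haveI : CompleteSpace E := FiniteDimensional.complete ℝ E
  have hE : 0 < Module.finrank ℝ E := Module.finrank_pos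
  have h0I : (0 : ℝ) ∈ Icc 0 T := ⟨le_rfl, hT.le⟩
  have htI : t ∈ Icc 0 T := ⟨ht.1.le, ht.2⟩
  have hbd' : ∀ τ ∈ Ioo 0 T, ∀ y, ‖u τ y‖ ≤ M := fun τ hτ y => hbd τ ⟨hτ.1.le, hτ.2.le⟩ y
  have hνt : 0 < ν * t := mul_pos hν ht.1
  obtain ⟨c, hc⟩ := exists_const_oseenMild_of_bounded_isMildNSSolutionOn hν hT hmild hmeas hsl hM
    hbd hdiv0 ht
  -- the three pieces and their classes
  set h : E → E := UnboundedOperators.heatExtension (u 0) (ν * t) with hh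
  set Bt : E → E := oseenDuhamel ν 0 u u t with hBt
  have hu0m : MemLp (u 0) ∞ (volume : Measure E) :=
    memLp_top_of_bound (hsl 0 h0I) M (Eventually.of_forall (hbd 0 h0I))
  have hh_cont : Continuous h :=
    (UnboundedOperators.contDiff_heatExtension_holds hu0m le_top hνt).continuous
  have hh_bd : ∀ x, ‖h x‖ ≤ M := fun x => UnboundedOperators.norm_heatExtension_le (hbd 0 h0I) hνt x
  have hh_m : MemLp h ∞ (volume : Measure E) :=
    memLp_top_of_bound hh_cont.aestronglyMeasurable M (Eventually.of_forall hh_bd)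
  have hh_2 : MemLp h 2 (volume : Measure E) :=
    UnboundedOperators.memLp_heatExtension_holds (h2 0 h0I) (by norm_num) hνt
  obtain ⟨CB, hCB, hCBle⟩ := exists_norm_oseenDuhamel_bounded_le (E := E)
  have hBt_bd : ∀ x, ‖Bt x‖ ≤ CB * M ^ 2 * ν ^ (-(1 / 2 : ℝ)) * (2 * Real.sqrt (t - 0)) := fun x =>
    hCBle hν ht.1 hM.le (fun τ hτ y => hbd' τ ⟨hτ.1, hτ.2.trans_le ht.2⟩ y)
      (fun τ hτ y => hbd' τ ⟨hτ.1, hτ.2.trans_le ht.2⟩ y) x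
  have hBt_meas : AEStronglyMeasurable Bt (volume : Measure E) :=
    aestronglyMeasurable_oseenDuhamel hν hmeas hmeas hM.le hbd' hbd' ht.1 ht.2
  have hBt_m : MemLp Bt ∞ (volume : Measure E) :=
    memLp_top_of_bound hBt_meas _ (Eventually.of_forall hBt_bd)
  have hut_m : MemLp (u t) ∞ (volume : Measure E) :=
    memLp_top_of_bound (hsl t htI) M (Eventually.of_forall (hbd t htI))
  -- `z = h - Bt - u t = c` a.e.
  set z : E → E := h - Bt - u t with hz
  have hzc : z =ᵐ[volume] fun _ => c := by
    filter_upwards [hc] with x hx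
    simp only [hz, Pi.sub_apply]
    rw [hx]
    simp only [hh, hBt]
    abel
  -- `e^{τΔ} z (0) = c` and `= e^{τΔ}h(0) - e^{τΔ}Bt(0) - e^{τΔ}(u t)(0)`
  have hcτ : ∀ τ : ℝ, 0 < τ → c = UnboundedOperators.heatExtension h τ 0 -
      UnboundedOperators.heatExtension Bt τ 0 - UnboundedOperators.heatExtension (u t) τ 0 := by
    intro τ hτ
    have e1 : UnboundedOperators.heatExtension z τ 0 = c := by
      rw [heatExtension_congr_ae hzc τ, UnboundedOperators.heatExtension_const c hτ 0]
    have e2 : UnboundedOperators.heatExtension z τ =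
        UnboundedOperators.heatExtension h τ - UnboundedOperators.heatExtension Bt τ -
          UnboundedOperators.heatExtension (u t) τ := by
      rw [hz, heatExtension_sub_eq_of_memLp (hh_m.sub hBt_m) hut_m le_top hτ,
        heatExtension_sub_eq_of_memLp hh_m hBt_m le_top hτ]
    rw [← e1, e2]
    rfl
  -- a strongly measurable bounded representative of `u` on `(0, t) × E`, for the decay of `Bt`
  have hjm : AEStronglyMeasurable (uncurry u)
      ((volume : Measure (ℝ × E)).restrict (Ioo 0 t ×ˢ univ)) :=
    hmeas.mono_measure (Measure.restrict_mono (prod_mono (Ioo_subset_Ioo_right ht.2) Subset.rfl) le_rfl)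
  obtain ⟨w, hwm, hwb, hwu⟩ := exists_stronglyMeasurable_representative hM hjm
    (fun τ hτ => Eventually.of_forall (hbd' τ ⟨hτ.1, hτ.2.trans_le ht.2⟩))
  have hBw : oseenDuhamel ν 0 w w t = Bt := funext fun x => oseenDuhamel_congr_ae_slices hwu x
  obtain ⟨CD, hCD⟩ := exists_norm_heatExtension_oseenDuhamel_le hwm hM.le hwb hν ht.1
  rw [hBw] at hCD
  -- ### the three terms tend to zero as `τ → ∞`
  have lim_h : Tendsto (fun τ : ℝ => ‖UnboundedOperators.heatExtension h τ 0‖) atTop (𝓝 0) := by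
    have h1 := UnboundedOperators.tendsto_enorm_heatExtension_atTop hh_2 (by norm_num)
      (by norm_num) hE (0 : E)
    have h2 := (ENNReal.tendsto_toReal ENNReal.zero_ne_top).comp h1
    rw [ENNReal.toReal_zero] at h2
    exact h2.congr fun σ => by simp
  have lim_u : Tendsto (fun τ : ℝ => ‖UnboundedOperators.heatExtension (u t) τ 0‖) atTop (𝓝 0) := by
    have h1 := UnboundedOperators.tendsto_enorm_heatExtension_atTop (h2 t htI) (by norm_num)
      (by norm_num) hE (0 : E)
    have h2' := (ENNReal.tendsto_toReal ENNReal.zero_ne_top).comp h1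
    rw [ENNReal.toReal_zero] at h2'
    exact h2'.congr fun σ => by simp
  have lim_B : Tendsto (fun τ : ℝ => ‖UnboundedOperators.heatExtension Bt τ 0‖) atTop (𝓝 0) := by
    have h1 : Tendsto (fun τ : ℝ => CD * τ ^ (-(1 / 2 : ℝ))) atTop (𝓝 0) := by
      have := (tendsto_rpow_neg_atTop (y := 1 / 2) (by norm_num)).const_mul CD
      simpa using this
    refine squeeze_zero' (Eventually.of_forall fun τ => norm_nonneg _) ?_ h1
    filter_upwards [eventually_gt_atTop 0] with τ hτ
    exact hCD hτ 0
  -- hence `c = 0`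
  have hc0 : c = 0 := by
    have hlim : Tendsto (fun τ : ℝ => ‖UnboundedOperators.heatExtension h τ 0‖ +
        ‖UnboundedOperators.heatExtension Bt τ 0‖ + ‖UnboundedOperators.heatExtension (u t) τ 0‖)
        atTop (𝓝 0) := by
      simpa using (lim_h.add lim_B).add lim_u
    have hle : ∀ᶠ τ : ℝ in atTop, ‖c‖ ≤ ‖UnboundedOperators.heatExtension h τ 0‖ +
        ‖UnboundedOperators.heatExtension Bt τ 0‖ + ‖UnboundedOperators.heatExtension (u t) τ 0‖ := by
      filter_upwards [eventually_gt_atTop 0] with τ hτ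
      calc ‖c‖ = ‖UnboundedOperators.heatExtension h τ 0 - UnboundedOperators.heatExtension Bt τ 0 -
            UnboundedOperators.heatExtension (u t) τ 0‖ := by rw [← hcτ τ hτ]
        _ ≤ ‖UnboundedOperators.heatExtension h τ 0 - UnboundedOperators.heatExtension Bt τ 0‖ +
            ‖UnboundedOperators.heatExtension (u t) τ 0‖ := norm_sub_le _ _
        _ ≤ ‖UnboundedOperators.heatExtension h τ 0‖ + ‖UnboundedOperators.heatExtension Bt τ 0‖ +
            ‖UnboundedOperators.heatExtension (u t) τ 0‖ := by
            gcongr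
            exact norm_sub_le _ _
    have h0 : ‖c‖ ≤ 0 := ge_of_tendsto hlim hle
    exact norm_le_zero_iff.1 h0
  -- conclusion
  filter_upwards [hc] with x hx
  rw [hx, hc0, sub_zero]

end Representation

end Literature.Analysis.FluidPDE

end
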